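import Summits.QuantumFields.BalabanUV.Beta.GAN24.BlockCommutatorStepLetter
import Summits.QuantumFields.BalabanUV.Beta.GAN24.KSlotCombChart
import Summits.QuantumFields.BalabanUV.Beta.GAN24.CombSpureRowsOfSRows

/-!
# `BalabanUV.Beta.GAN24.CombBlockCommutatorStepLetter` — binder row G-an2-4 ∕ (CONV-C), TRANSFER-III (the (α-0) chain at row D1's literal of record (III′)), link L8b:
# **THE S-STEP SLOT LETTER ROWS `hE₁ ∕ hE₂` AT `ε = 1`, UNIFORMLY IN THE LEVEL, FOR ANY KERNEL FAMILY WITH A UNIFORM UNIT ROW, ANY FIRST-ORDER TABLE FAMILY WITH A UNIFORM UNIT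
# ROW, AND THE BLOCK GENERATOR AT ANY SCALE `ξ`; THE COMB-CHART INSTANCE AT an1's RECORD MODULO THE S-SLOT ROWS AND ONE SCALAR ROW** — the slot ∕ (III′) twin of road-P2 g45's
# (E) `BlockCommutatorStepLetter` §2 (`exists_evenRows_uniform_of_rows`, stated for `K♮ᴱ_l = unitK_l (coDressKBmAt ρ Lc (KInvStep Lc l))`, `S_l = SpureRecAt … ρ … l`, `ξ = ½`) and §3
# (G-an2-4 CRUX TEAM (2), leaf prover `b2b-balaban-gan24-formalise-leaf-01`, gen 82 — crew GAN's kept leaf prover; the rows produced are EXACTLY the displayed binders `hE` of MY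
# `CombSlavedDivRowsOfWardLetters` ∕ `hE₁ hE₂` of MY g80 PART 4′ `CombHalfMemberSlavedDivergenceLetters` at `ε = 1`; first refusal road-P2 honoured by the journal INTENT; no existing
# file touched)

NOT IN PRINT; OUR BOOKKEEPING ([folklore] composition BY NAME: leaf-03 g66's generic `SlavedSummandLetterRows.evenRows_of_Srow` level by level, §1 for the block symbol at scale
`ξ`, the constant made monotone in the scalar `|(sf_l·sm_l)⁻¹·(cH l)⁻¹| ≤ c₀` — road-P2 g45's §2 text token for token with `(K♮ᴱ, S, ½) ↦ (unitK ∘ K, S, ξ)` generic; §3 plugs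
leaf-02 g77's (III′) K-slot `KSlotCombChart.kSlotCombSh_holds` and leaf-02 g79's «S′ from S» `CombSpureRowsOfSRows.exists_spureCombOf_rows_three_of_scombOf_rows`; 0 `def`, 0 cited
facts, 0 `def … : Prop`, 0 sorry).  HONEST FRAMING (cell contract, verbatim): «discharging `BetaPertH` makes Bałaban's UV stability UNCONDITIONAL — a real constructive-QFT
result; it is NOT the continuum limit and NOT the Clay problem.»  HONEST DEPENDENCY (verbatim): «continuum YM on T⁴ ⇐ BetaPertH ∧ nine spine estimates (0/9 proved); BetaPertH ⇐
(D1) ∧ (D4) ∧ CAP+tail; G-an2-4 gates asym, D1 and NE2/3/4.»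

WHAT (in-block root `ρ = toSite r`, unit scalars `sfStep ∕ smStep`, block generators `X p = diagK (ξ • Σ_{v ∈ box} legInd ρ (Lc • p + v))` at ANY scale `ξ` — an2's
slot-generic table laws `WardLocusQuarticTableSlot.tableLaw_T2RecOf_succ ∕ _zero` carry a generic `ξ`; road-P2's (E) laws have `ξ = ½`):
* §1 (generic `d`) `abs_blockLegInd_smul_le` (`|(ξ • Σ legInd ρ (Lc•p+v)) z b| ≤ |ξ|·#box`), `blockLegInd_smul_support` (supported on the block's legs, width `2·((d+1)·Lc)`,
  from road-P2's `blockLegInd_support`).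
* §2 (generic `d`, `1 ≤ Lc`, ANY families `K : ℕ → MKer`, `S : ℕ → …`) **`exists_evenRows_uniform_of_rows_smul`** — A SOCKET: from a uniform unit row of the kernels
  `hG : ∀ j, Decays (unitK_j (K j)) C δ`, a uniform unit row of the tables `hS : ∀ j, LocStencil (unitS_j (S j)) Cs δs` and ONE scalar row `hcH : ∀ l, |(sf_l·sm_l)⁻¹·(cH l)⁻¹| ≤ c₀`:
  `∃ CE δE, 0 < δE ∧ ∀ l, hE₁(l) ∧ hE₂(l)` with ONE `(CE, δE)` — the binders `hE₁ ∕ hE₂` of PART 4 ∕ 4′ at `ε = 1` for ANY residual letters `R l`, `R″ l` (factor `(1 − 1)/2 = 0`).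
* §3 (`d = 3`, `2 ≤ Lc`, an1's record `symTablesAn1S2 3 Lc cΛt`, every `cE cVH cΛ ξ cout`, every in-block root) **`exists_comb_evenRows_uniform_three`** — §2 at the comb-chart
  kernels `GcombSh Lc` (uniform unit row = leaf-02's (III′) K-slot, hypothesis-free) and the unfolded comb-chart tables `SpureCombOf (symTablesAn1S2 3 Lc cΛt) cE cVH cΛ`
  («S′Shape» ⟸ the S-slot rows (hS, hSall) of `ScombOf …` by leaf-02 g79): the rows for ALL levels MODULO (hS, hSall) AND `hcH` ONLY.
READING (zero weight): at (E) road-P2's §3 discharged (hS, hSall) down to the OWNER's S-slot END; at (III′) the S-slot rows of `ScombOf` are the S′-campaign's (road-P2 g56's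
M.104 `CombSRowsOfContactLetters` reduces them to six contact letters) — DISPLAYED here.  CONDITIONAL on the displayed rows; asserts NO bound on Bałaban's tables beyond them;
discharges NOTHING of `hcell` ∕ (Q-L) ∕ (C) ∕ one S-∕W-slot row; the (III′) campaign is NOT asked (an2 W-4 l.64553); NEVER «G-an2-4 closed» as (CONV-C); NOT D1, NOT
`BetaPertH`, NOT continuum, NOT Clay; not in print.  2026-08-25.
-/

noncomputable section

open Finset
open scoped BigOperators
open Literature.MathematicalPhysics.QuantumFieldTheory
open Literature.MathematicalPhysics.QuantumFieldTheory.Balaban1983to89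
open Literature.MathematicalPhysics.QuantumFieldTheory.Balaban1983to89.Beta
open B12Sec2to5 (l1 l1_nonneg)
open ExpKernelCalculus (MKer Decays Zl comp Zl_nonneg)
open OneStepResolventKernel (Fib LocStencil)
open AffineAveraging (box toSite)
open BalabanCompositeJets (LocStencil₂)
open Summit.QuantumFields.BalabanUV.Beta.BorderedHessian (diagK)
open Summit.QuantumFields.BalabanUV.Beta.AveragingWardRootedStencils (legInd legInd_apply)
open Summit.QuantumFields.BalabanUV.Beta.HessKerDressedUnits (unitK unitS)
open Summit.QuantumFields.BalabanUV.Beta.SpineRooted (e3OfK)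
open Summit.QuantumFields.BalabanUV.Beta.CombChartStepJets (GcombSh ScombOf SpureCombOf)
open Summit.QuantumFields.BalabanUV.Beta.SymSecondOrderTablesAn1 (symTablesAn1S2)
open Summit.QuantumFields.BalabanUV.Beta.GAN24.CombesThomas (sfStep smStep)
open Summit.QuantumFields.BalabanUV.Beta.GAN24.WSlotCauchyOfShapes (locStencil₂_le_mono)
open Summit.QuantumFields.BalabanUV.Beta.GAN24.SlavedSummandLetterRows (evenRows_of_Srow)
open Summit.QuantumFields.BalabanUV.Beta.GAN24.BlockCommutatorStepLetter (blockLegInd_support)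
open Summit.QuantumFields.BalabanUV.Beta.GAN24.KSlotCombChart (kSlotCombSh_holds)
open Summit.QuantumFields.BalabanUV.Beta.GAN24.CombSpureRowsOfSRows (exists_spureCombOf_rows_three_of_scombOf_rows)

namespace Summit.QuantumFields.BalabanUV.Beta.GAN24.CombBlockCommutatorStepLetter

variable {d : ℕ} {Lc : ℕ} [NeZero Lc] {r : Fin (d + 1) → ℕ}

/-! ## §1 The block's diagonal generator at scale `ξ`: bounded, supported on the block's legs -/

omit [NeZero Lc] in
/-- [folklore] **THE BLOCK's LEG-INDICATOR SYMBOL AT SCALE `ξ` IS BOUNDED**: `|(ξ • Σ_{v∈box} legInd ρ (Lc•p + v)) z b| ≤ |ξ|·#box` (road-P2's `abs_blockLegInd_le` is `ξ = ½`). -/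
theorem abs_blockLegInd_smul_le (ξ : ℝ) (ρ p z : Fin (d + 1) → ℤ) (b : Fib d) :
    |(ξ • ∑ v ∈ box (d + 1) Lc, legInd ρ ((Lc : ℤ) • p + toSite v)) z b| ≤ |ξ| * (box (d + 1) Lc).card := by
  rw [Pi.smul_apply, Pi.smul_apply, Finset.sum_apply, Finset.sum_apply, smul_eq_mul, abs_mul]
  refine mul_le_mul_of_nonneg_left ((Finset.abs_sum_le_sum_abs _ _).trans ?_) (abs_nonneg _)
  have h : ∀ v ∈ box (d + 1) Lc, |legInd ρ ((Lc : ℤ) • p + toSite v) z b| ≤ 1 := by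
    intro v _
    rw [legInd_apply]
    split_ifs <;> simp
  refine (Finset.sum_le_sum h).trans ?_
  rw [Finset.sum_const, nsmul_eq_mul, mul_one]

omit [NeZero Lc] in
/-- [folklore] **THE BLOCK's LEG-INDICATOR SYMBOL AT SCALE `ξ` IS SUPPORTED ON THE BLOCK's LEGS**: for an in-block root `ρ = toSite r`,
`(ξ • Σ_{v∈box} legInd ρ (Lc•p + v)) z b ≠ 0 → |z − Lc•p|₁ ≤ 2·((d+1)·Lc)` (road-P2's `blockLegInd_support`, the scale traded through `ξ·s ≠ 0 → ½·s ≠ 0`). -/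
theorem blockLegInd_smul_support (hr : r ∈ box (d + 1) Lc) (ξ : ℝ) (p z : Fin (d + 1) → ℤ) (b : Fib d)
    (h : (ξ • ∑ v ∈ box (d + 1) Lc, legInd (toSite r) ((Lc : ℤ) • p + toSite v)) z b ≠ 0) :
    l1 (z - (Lc : ℤ) • p) ≤ 2 * (((d + 1 : ℕ) : ℝ) * Lc) := by
  refine blockLegInd_support hr p z b ?_
  rw [Pi.smul_apply, Pi.smul_apply, smul_eq_mul] at h ⊢
  intro h0
  exact h (by rw [(mul_eq_zero.mp h0).resolve_left (by norm_num), mul_zero])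

/-! ## §2 Generic `d`: the rows `hE₁ ∕ hE₂` at `ε = 1` for ANY kernel ∕ table families with uniform unit rows, ONE `(CE, δE)` FOR ALL LEVELS -/

omit [NeZero Lc] in
/-- NOT IN PRINT; OUR BOOKKEEPING — A SOCKET ([folklore] composition: leaf-03 g66's `SlavedSummandLetterRows.evenRows_of_Srow` level by level, §1 for the block symbol at
scale `ξ`, and the monotonicity of its constant in the scalar `|(sf_l·sm_l)⁻¹·(cH l)⁻¹|`; generic `d`, in-block root `r`, `1 ≤ Lc`; ANY kernel family `K : ℕ → MKer` and ANY
first-order table family `S : ℕ → …`).  **THE S-STEP LETTER ROWS `hE₁ ∕ hE₂` AT `ε = 1` FOR THE UNIT KERNELS `unitK_l (K l)`, THE TABLES `S l`, THE BLOCK GENERATORS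
`X p = diagK (ξ • Σ_{v∈box} legInd ρ (Lc•p + v))`, ANY residual letters `R l`, `R″ l`, ANY lock constants `cH l` — UNIFORMLY IN THE LEVEL**: from `hG : ∀ j, Decays (unitK_j (K j)) C δ`,
`hS : ∀ j, LocStencil (unitS_j (S j)) Cs δs` and `hcH : ∀ l, |(sf_l·sm_l)⁻¹·(cH l)⁻¹| ≤ c₀`, `∃ CE δE, 0 < δE ∧ ∀ l, hE₁(l) ∧ hE₂(l)` with ONE `(CE, δE)`.  The (E) socket
`BlockCommutatorStepLetter.exists_evenRows_uniform_of_rows` is the instance `K := coDressKBmAt ρ Lc ∘ KInvStep Lc`, `S := SpureRecAt … ρ …`, `ξ := ½`; the rows are the binders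
`hE₁ ∕ hE₂` of PART 4′ `CombHalfMemberSlavedDivergenceLetters.slotLetters_halfMember_comb_succ_of_rows` (at `K := GcombSh Lc`) at `ε = 1`.  Asserts NO bound beyond the displayed rows. -/
theorem exists_evenRows_uniform_of_rows_smul (hLc : 1 ≤ Lc) (hr : r ∈ box (d + 1) Lc) (ξ cout : ℝ) (cH : ℕ → ℝ) {c₀ : ℝ}
    (hcH : ∀ l, |(sfStep Lc l * smStep d Lc l)⁻¹ * (cH l)⁻¹| ≤ c₀)
    {K : ℕ → MKer (d + 1) (Fib d)} {C δ : ℝ} (hG : ∀ j, Decays (unitK (sfStep Lc j) (smStep d Lc j) (K j)) C δ) (hδ : 0 < δ)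
    {S : ℕ → Fin (d + 1) → (Fin (d + 1) → ℤ) → MKer (d + 1) (Fib d)} {Cs δs : ℝ}
    (hS : ∀ j, LocStencil (unitS (sfStep Lc j) (smStep d Lc j) (S j)) Cs δs) (hδs : 0 < δs)
    (R R'' : ℕ → (Fin (d + 1) → ℤ) → Fin (d + 1) → (Fin (d + 1) → ℤ) → MKer (d + 1) (Fib d)) :
    ∃ CE δE : ℝ, 0 < δE ∧ ∀ l,
      LocStencil₂ (fun (_ : Fin (d + 1)) (p : Fin (d + 1) → ℤ) (κ' : Fin (d + 1)) (u' : Fin (d + 1) → ℤ) =>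
          cout • (e3OfK Lc (unitK (sfStep Lc l) (smStep d Lc l) (K l))
              (fun κ' u' => (sfStep Lc l * smStep d Lc l)⁻¹ • unitS (sfStep Lc l) (smStep d Lc l)
                (fun κ' u' => (cH l)⁻¹ • ((((1 : ℝ) + 1) / 2) • (comp (S l κ' u') (diagK (ξ • ∑ v ∈ box (d + 1) Lc, legInd (toSite r) ((Lc : ℤ) • p + toSite v)))
                  - comp (diagK (ξ • ∑ v ∈ box (d + 1) Lc, legInd (toSite r) ((Lc : ℤ) • p + toSite v))) (S l κ' u')) + (((1 : ℝ) - 1) / 2) • R l p κ' u')) κ' u') κ' u'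
            + e3OfK Lc (unitK (sfStep Lc l) (smStep d Lc l) (K l))
              (fun κ u => (sfStep Lc l * smStep d Lc l)⁻¹ • unitS (sfStep Lc l) (smStep d Lc l)
                (fun κ u => (cH l)⁻¹ • ((((1 : ℝ) + 1) / 2) • (comp (S l κ u) (diagK (ξ • ∑ v ∈ box (d + 1) Lc, legInd (toSite r) ((Lc : ℤ) • p + toSite v)))
                  - comp (diagK (ξ • ∑ v ∈ box (d + 1) Lc, legInd (toSite r) ((Lc : ℤ) • p + toSite v))) (S l κ u)) + (((1 : ℝ) - 1) / 2) • R'' l p κ u)) κ u) κ' u')) CE δE ∧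
      LocStencil₂ (fun (κ : Fin (d + 1)) (u : Fin (d + 1) → ℤ) (_ : Fin (d + 1)) (p : Fin (d + 1) → ℤ) =>
          cout • (e3OfK Lc (unitK (sfStep Lc l) (smStep d Lc l) (K l))
              (fun κ' u' => (sfStep Lc l * smStep d Lc l)⁻¹ • unitS (sfStep Lc l) (smStep d Lc l)
                (fun κ' u' => (cH l)⁻¹ • ((((1 : ℝ) + 1) / 2) • (comp (S l κ' u') (diagK (ξ • ∑ v ∈ box (d + 1) Lc, legInd (toSite r) ((Lc : ℤ) • p + toSite v)))
                  - comp (diagK (ξ • ∑ v ∈ box (d + 1) Lc, legInd (toSite r) ((Lc : ℤ) • p + toSite v))) (S l κ' u')) + (((1 : ℝ) - 1) / 2) • R l p κ' u')) κ' u') κ u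
            + e3OfK Lc (unitK (sfStep Lc l) (smStep d Lc l) (K l))
              (fun κ u => (sfStep Lc l * smStep d Lc l)⁻¹ • unitS (sfStep Lc l) (smStep d Lc l)
                (fun κ u => (cH l)⁻¹ • ((((1 : ℝ) + 1) / 2) • (comp (S l κ u) (diagK (ξ • ∑ v ∈ box (d + 1) Lc, legInd (toSite r) ((Lc : ℤ) • p + toSite v)))
                  - comp (diagK (ξ • ∑ v ∈ box (d + 1) Lc, legInd (toSite r) ((Lc : ℤ) • p + toSite v))) (S l κ u)) + (((1 : ℝ) - 1) / 2) • R'' l p κ u)) κ u) κ u)) CE δE := by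
  have hC : 0 ≤ C := (hG 0).nonneg (Sum.inl 0)
  have hCs : 0 ≤ Cs := ((hS 0) 0 0).nonneg (Sum.inl 0)
  have hc₀ : 0 ≤ c₀ := (abs_nonneg _).trans (hcH 0)
  have hm : 0 < min δs δ / 2 := by positivity
  have hZ0 : 0 ≤ Zl (d + 1) (min δs δ / 2) := Zl_nonneg hm
  have hZ1 : 0 ≤ Zl (d + 1) (min δs δ / 2 / 2 - min δs δ / 2 / 4) := Zl_nonneg (by linarith)
  have hZ2 : 0 ≤ Zl (d + 1) (min δs δ / 2 / 4 - min δs δ / 2 / 8) := Zl_nonneg (by linarith)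
  -- the constant of `evenRows_of_Srow` as a function of the scalar `q = |(sf·sm)⁻¹·cH⁻¹|`
  set M : ℝ := (Fintype.card (Fib d) : ℝ) * ((Fintype.card (Fib d) : ℝ) * (C * (2 * (|ξ| * (box (d + 1) Lc).card) *
      (((d + 1 : ℕ) : ℝ) * (C * Cs * Zl (d + 1) (min δs δ / 2))) * Real.exp (min δs δ / 2 / 2 * (2 * (((d + 1 : ℕ) : ℝ) * Lc))))) *
      Zl (d + 1) (min δs δ / 2 / 2 - min δs δ / 2 / 4) * C) * Zl (d + 1) (min δs δ / 2 / 4 - min δs δ / 2 / 8) with hM_def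
  have hM : 0 ≤ M := by positivity
  refine ⟨|cout| * (c₀ * M + c₀ * M), min δs δ / 2 / 8, by positivity, fun l => ?_⟩
  have h := evenRows_of_Srow (N := Lc) (R := R l) (R'' := R'' l)
    (X := fun p => diagK (ξ • ∑ v ∈ box (d + 1) Lc, legInd (toSite r) ((Lc : ℤ) • p + toSite v)))
    (g := fun p => ξ • ∑ v ∈ box (d + 1) Lc, legInd (toSite r) ((Lc : ℤ) • p + toSite v))
    hLc (hG l) hδ (sfStep Lc l) (smStep d Lc l) (cH l) cout (hS l) hδs (fun p => rfl)
    (fun p z b => abs_blockLegInd_smul_le ξ (toSite r) p z b) (fun p z b hh => blockLegInd_smul_support hr ξ p z b hh)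
  -- the level-`l` constant is `|cout|·(q_l·M + q_l·M)`, monotone in `q_l ≤ c₀`
  have hq := hcH l
  have eA : (Fintype.card (Fib d) : ℝ) * ((Fintype.card (Fib d) : ℝ) * (C * (2 * |(sfStep Lc l * smStep d Lc l)⁻¹ * (cH l)⁻¹| *
      (|ξ| * (box (d + 1) Lc).card) * (((d + 1 : ℕ) : ℝ) * (C * Cs * Zl (d + 1) (min δs δ / 2))) *
      Real.exp (min δs δ / 2 / 2 * (2 * (((d + 1 : ℕ) : ℝ) * Lc))))) * Zl (d + 1) (min δs δ / 2 / 2 - min δs δ / 2 / 4) * C) *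
      Zl (d + 1) (min δs δ / 2 / 4 - min δs δ / 2 / 8) = |(sfStep Lc l * smStep d Lc l)⁻¹ * (cH l)⁻¹| * M := by
    rw [hM_def]; ring
  rw [eA] at h
  have hle : |cout| * (|(sfStep Lc l * smStep d Lc l)⁻¹ * (cH l)⁻¹| * M + |(sfStep Lc l * smStep d Lc l)⁻¹ * (cH l)⁻¹| * M) ≤ |cout| * (c₀ * M + c₀ * M) :=
    mul_le_mul_of_nonneg_left (add_le_add (mul_le_mul_of_nonneg_right hq hM) (mul_le_mul_of_nonneg_right hq hM)) (abs_nonneg _)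
  exact ⟨locStencil₂_le_mono h.1 hle le_rfl, locStencil₂_le_mono h.2 hle le_rfl⟩

/-! ## §3 `d = 3`, `Lc ≥ 2`, an1's record: the rows for all levels at the comb-chart data, modulo the S-slot rows of `ScombOf` and the scalar row -/

/-- NOT IN PRINT; OUR BOOKKEEPING ([folklore] composition: §2 ∘ leaf-02 g77's (III′) K-slot `KSlotCombChart.kSlotCombSh_holds` (the uniform unit row of the comb-chart kernels
`unitK_j (GcombSh Lc j)`, hypothesis-free) ∘ leaf-02 g79's `CombSpureRowsOfSRows.exists_spureCombOf_rows_three_of_scombOf_rows` («S′Shape» of `unitS_j (SpureCombOf …)` ⟸ the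
S-slot rows (hS, hSall) of `unitS_j (ScombOf …)`)).  **THE S-STEP LETTER ROWS `hE₁ ∕ hE₂` AT `d = 3` FOR THE COMB-CHART DATA AT an1's RECORD `symTablesAn1S2 3 Lc cΛt`, ALL LEVELS
WITH ONE `(CE, δE)`, MODULO THE S-SLOT ROWS (hS, hSall) OF `ScombOf` AND THE SCALAR ROW `hcH` ONLY** (`2 ≤ Lc`, every `cΛt cE cVH cΛ ξ cout`, every in-block root `r`, any
residual letters `R l`, `R″ l`, any lock constants `cH l`).  The (III′) twin of road-P2's `exists_evenRows_uniform_three` — there (hS, hSall) were the OWNER g22's S-slot END at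
chart (II); here they are the S′-campaign's rows, DISPLAYED.  Discharges NOTHING of `hcell` ∕ (Q-L) ∕ (C) ∕ the S-slot; NEVER «G-an2-4 closed» as (CONV-C). -/
theorem exists_comb_evenRows_uniform_three (hLc : 2 ≤ Lc) (cΛt cE cVH cΛ ξ cout : ℝ) {r : Fin (3 + 1) → ℕ} (hr : r ∈ box (3 + 1) Lc)
    (cH : ℕ → ℝ) {c₀ : ℝ} (hcH : ∀ l, |(sfStep Lc l * smStep 3 Lc l)⁻¹ * (cH l)⁻¹| ≤ c₀) {Cs cS θS δS : ℝ}
    (hS : ∀ j, LocStencil (unitS (sfStep Lc j) (smStep 3 Lc j) (ScombOf (symTablesAn1S2 3 Lc cΛt) cE cVH cΛ j)) Cs δS)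
    (hSall : ∀ k j, LocStencil (unitS (sfStep Lc (k + j)) (smStep 3 Lc (k + j)) (ScombOf (symTablesAn1S2 3 Lc cΛt) cE cVH cΛ (k + j)) -
      unitS (sfStep Lc k) (smStep 3 Lc k) (ScombOf (symTablesAn1S2 3 Lc cΛt) cE cVH cΛ k)) (cS * θS ^ k) δS)
    (hδS : 0 < δS) (hθS0 : 0 ≤ θS) (hθS1 : θS < 1)
    (R R'' : ℕ → (Fin (3 + 1) → ℤ) → Fin (3 + 1) → (Fin (3 + 1) → ℤ) → MKer (3 + 1) (Fib 3)) :
    ∃ CE δE : ℝ, 0 < δE ∧ ∀ l,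
      LocStencil₂ (fun (_ : Fin (3 + 1)) (p : Fin (3 + 1) → ℤ) (κ' : Fin (3 + 1)) (u' : Fin (3 + 1) → ℤ) =>
          cout • (e3OfK Lc (unitK (sfStep Lc l) (smStep 3 Lc l) (GcombSh (d := 3) Lc l))
              (fun κ' u' => (sfStep Lc l * smStep 3 Lc l)⁻¹ • unitS (sfStep Lc l) (smStep 3 Lc l)
                (fun κ' u' => (cH l)⁻¹ • ((((1 : ℝ) + 1) / 2) • (comp (SpureCombOf (symTablesAn1S2 3 Lc cΛt) cE cVH cΛ l κ' u') (diagK (ξ • ∑ v ∈ box (3 + 1) Lc, legInd (toSite r) ((Lc : ℤ) • p + toSite v)))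
                  - comp (diagK (ξ • ∑ v ∈ box (3 + 1) Lc, legInd (toSite r) ((Lc : ℤ) • p + toSite v))) (SpureCombOf (symTablesAn1S2 3 Lc cΛt) cE cVH cΛ l κ' u')) + (((1 : ℝ) - 1) / 2) • R l p κ' u')) κ' u') κ' u'
            + e3OfK Lc (unitK (sfStep Lc l) (smStep 3 Lc l) (GcombSh (d := 3) Lc l))
              (fun κ u => (sfStep Lc l * smStep 3 Lc l)⁻¹ • unitS (sfStep Lc l) (smStep 3 Lc l)
                (fun κ u => (cH l)⁻¹ • ((((1 : ℝ) + 1) / 2) • (comp (SpureCombOf (symTablesAn1S2 3 Lc cΛt) cE cVH cΛ l κ u) (diagK (ξ • ∑ v ∈ box (3 + 1) Lc, legInd (toSite r) ((Lc : ℤ) • p + toSite v)))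
                  - comp (diagK (ξ • ∑ v ∈ box (3 + 1) Lc, legInd (toSite r) ((Lc : ℤ) • p + toSite v))) (SpureCombOf (symTablesAn1S2 3 Lc cΛt) cE cVH cΛ l κ u)) + (((1 : ℝ) - 1) / 2) • R'' l p κ u)) κ u) κ' u')) CE δE ∧
      LocStencil₂ (fun (κ : Fin (3 + 1)) (u : Fin (3 + 1) → ℤ) (_ : Fin (3 + 1)) (p : Fin (3 + 1) → ℤ) =>
          cout • (e3OfK Lc (unitK (sfStep Lc l) (smStep 3 Lc l) (GcombSh (d := 3) Lc l))
              (fun κ' u' => (sfStep Lc l * smStep 3 Lc l)⁻¹ • unitS (sfStep Lc l) (smStep 3 Lc l)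
                (fun κ' u' => (cH l)⁻¹ • ((((1 : ℝ) + 1) / 2) • (comp (SpureCombOf (symTablesAn1S2 3 Lc cΛt) cE cVH cΛ l κ' u') (diagK (ξ • ∑ v ∈ box (3 + 1) Lc, legInd (toSite r) ((Lc : ℤ) • p + toSite v)))
                  - comp (diagK (ξ • ∑ v ∈ box (3 + 1) Lc, legInd (toSite r) ((Lc : ℤ) • p + toSite v))) (SpureCombOf (symTablesAn1S2 3 Lc cΛt) cE cVH cΛ l κ' u')) + (((1 : ℝ) - 1) / 2) • R l p κ' u')) κ' u') κ u
            + e3OfK Lc (unitK (sfStep Lc l) (smStep 3 Lc l) (GcombSh (d := 3) Lc l))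
              (fun κ u => (sfStep Lc l * smStep 3 Lc l)⁻¹ • unitS (sfStep Lc l) (smStep 3 Lc l)
                (fun κ u => (cH l)⁻¹ • ((((1 : ℝ) + 1) / 2) • (comp (SpureCombOf (symTablesAn1S2 3 Lc cΛt) cE cVH cΛ l κ u) (diagK (ξ • ∑ v ∈ box (3 + 1) Lc, legInd (toSite r) ((Lc : ℤ) • p + toSite v)))
                  - comp (diagK (ξ • ∑ v ∈ box (3 + 1) Lc, legInd (toSite r) ((Lc : ℤ) • p + toSite v))) (SpureCombOf (symTablesAn1S2 3 Lc cΛt) cE cVH cΛ l κ u)) + (((1 : ℝ) - 1) / 2) • R'' l p κ u)) κ u) κ u)) CE δE := by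
  have hLc1 : 1 ≤ Lc := by omega
  obtain ⟨C, δK, cK, θK, hδK, -, -, hG, -⟩ := kSlotCombSh_holds (Lc := Lc) hLc
  obtain ⟨Cs', cS', θ', δ', -, -, hδ', hS', -⟩ := exists_spureCombOf_rows_three_of_scombOf_rows hLc cΛt cE cVH cΛ hS hSall hδS hθS0 hθS1
  exact exists_evenRows_uniform_of_rows_smul hLc1 hr ξ cout cH hcH hG hδK hS' hδ' R R''

end Summit.QuantumFields.BalabanUV.Beta.GAN24.CombBlockCommutatorStepLetter

end
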